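import Summits.QuantumFields.YangMills.Theorems.ToronSmallBallSiteTwistDefs
import Summits.QuantumFields.YangMills.Theorems.QuantileBitPuritySU2ClassShiftDefs
import HarnessLib

/-!
# The own-axis sheet shift `ownShift θ` of a spatial `SU(2)` configuration — definitions

Defs module (D-0009) for the OWN-AXIS translate argument in the untwisted seam sector (crux ⟨stmt-QuantumFields-24089⟩
`ToronSmallBall.PeriodicOffCoreStripWindowDeep` of seat ym-idea-4's LINE g12-A, route `ToronSmallBall` rev 4; also ⟨24092⟩
`QuantileBitPurity.HolonomyLevyWindowDeepR`).  On the spatial torus `(ℤ/L)³` with `SU(2)` links, for every site `x` of the plane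
`x₀ = 0` the `x`-LINE HOLONOMY based at `x` is the tree's `lineHolonomy U 0 L x = U(x,0) U(x+e₀,0) ⋯ U(x+(L−1)e₀,0)` (first factor =
the plane link).  We define

* `ownAxisField θ U x = exp(ι(θ · axisVec (lineHolonomy U 0 L x)))` — the rotation by the angle `θ` about the OWN AXIS of the line
  holonomy through `x` (tree `ClassShift.axisVec`, `T4HaarSU2ExpChart.expPoint`);
* `ownShift θ U = siteTwist 0 (ownAxisField θ U) U` — the OWN-AXIS SHEET SHIFT: every `x`-link issuing from the plane `x₀ = 0` is
  multiplied on the left by the own-axis rotation of ITS line, so that every `x`-line holonomy `P` based on the plane becomes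
  `ClassShift.classShift θ P = exp(ι(θ · axisVec P)) · P` (class angle `r ↦ r + θ`, axis fixed), while all other links — in particular
  every `y`- and `z`-line — are untouched.  The shift is gauge covariant WITHOUT an external axis field (the axis of `g P g⁻¹` is the
  rotated axis), which is what makes it usable in the periodic seam sector; its one-line Jacobian is the tree's
  `ClassShift.lintegral_indicator_update_classShift_le`.

DEFINITIONS ONLY; the identities (holonomies, gauge covariance, Jacobian, action and time-coupling costs) are in the companion proof
modules `ToronSmallBallOwnAxisShift*`.  HONEST FRAMING: fixed-lattice bookkeeping objects; nothing about infinite volume, the continuum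
limit or the Clay gap.  References: [cite: Luscher1983, §2]; [cite: tHooft1979].
-/

set_option autoImplicit false

noncomputable section

open Literature.MathematicalPhysics.QuantumFieldTheory
open Literature.MathematicalPhysics.QuantumLattice
open Literature.MathematicalPhysics.QuantumFieldTheory.Balaban1983to89.T4HaarSU2ExpChart (expPoint)

namespace Summit.QuantumFields.YangMills.Theorems.FemtoTransferGap

variable {L : ℕ}

/-- **The own-axis rotation field** of a configuration: at the site `x`, the rotation by the angle `θ` about the axis of the
`x`-line holonomy `lineHolonomy U 0 L x` based at `x` (`= 1` when that holonomy is central). [cite: Luscher1983, §2] -/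
def ownAxisField (θ : ℝ) (U : GaugeConfig 3 L SU2) (x : Site 3 L) : SU2 :=
  expPoint (θ • ClassShift.axisVec (lineHolonomy U 0 L x))

/-- **The own-axis sheet shift**: multiply every `x`-link issuing from the plane `x₀ = 0` on the left by the own-axis rotation of
its line (`siteTwist 0 (ownAxisField θ U) U`); every line holonomy based on the plane becomes `classShift θ` of itself.
[cite: Luscher1983, §2] [cite: tHooft1979] -/
def ownShift (θ : ℝ) (U : GaugeConfig 3 L SU2) : GaugeConfig 3 L SU2 :=
  siteTwist 0 (ownAxisField θ U) U

/-- `ownAxisField` unfolded. [folklore] -/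
theorem ownAxisField_apply (θ : ℝ) (U : GaugeConfig 3 L SU2) (x : Site 3 L) :
    ownAxisField θ U x = expPoint (θ • ClassShift.axisVec (lineHolonomy U 0 L x)) := rfl

/-- `ownShift` unfolded. [folklore] -/
theorem ownShift_def (θ : ℝ) (U : GaugeConfig 3 L SU2) : ownShift θ U = siteTwist 0 (ownAxisField θ U) U := rfl

end Summit.QuantumFields.YangMills.Theorems.FemtoTransferGap

end
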